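import Summits.CriticalPhenomena.PercolationContinuityZ3.Theorems.PercNearOneGluingNoHeavyLowerTailCornerCuts
import HarnessLib

/-!
# `NoHeavyLowerTail` (stmt-CriticalPhenomena-4575) — corner programme: the PAIR-COVER lemma (pure finite combinatorics)

Used by layers 5b (CIL at the corner, every level) and 6 (guarded CIL): a finite family of nonempty finite sets in
which no three members each own an element missing from the other two ("no private triple") is pierced by TWO
points.  Proof: a member `R₁` of least size; if it is not contained in every member, the member `R₂ ⊉ R₁` minimising
`|R₁ ∪ R₂|`; pierce with `p ∈ R₁ ∖ R₂`, `q ∈ R₂ ∖ R₁` — a member missing both lies in `R₁ ∪ R₂` (no private triple) and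
beats the minimality of `R₂`.  [folklore] bookkeeping; nothing about the crux is asserted.
-/

namespace Summit.CriticalPhenomena.PercolationContinuityZ3.Theorems

namespace Corner

/-- **Two points pierce a family with no private triple.** If `R U` (`U ∈ 𝓡`, `𝓡` nonempty) are nonempty finite
sets such that no three of them each own an element missing from the other two, then two elements (taken from two of
the sets) meet every `R U`.  (Least-size member `R₁`; if it is not contained in every member, the member `R₂ ⊉ R₁`
minimising `|R₁ ∪ R₂|`; pierce with `p ∈ R₁ ∖ R₂`, `q ∈ R₂ ∖ R₁`.) [folklore] -/
theorem exists_pair_cover {α β : Type*} [DecidableEq β] (𝓡 : Finset α) (R : α → Finset β) (h0 : 𝓡.Nonempty)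
    (hne : ∀ U ∈ 𝓡, (R U).Nonempty)
    (h3 : ∀ U₁ ∈ 𝓡, ∀ U₂ ∈ 𝓡, ∀ U₃ ∈ 𝓡, ∀ a₁ ∈ R U₁, ∀ a₂ ∈ R U₂, ∀ a₃ ∈ R U₃,
      a₁ ∉ R U₂ → a₁ ∉ R U₃ → a₂ ∉ R U₁ → a₂ ∉ R U₃ → a₃ ∉ R U₁ → a₃ ∉ R U₂ → False) :
    ∃ U₁ ∈ 𝓡, ∃ U₂ ∈ 𝓡, ∃ t₁ ∈ R U₁, ∃ t₂ ∈ R U₂, ∀ U ∈ 𝓡, t₁ ∈ R U ∨ t₂ ∈ R U := by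
  obtain ⟨U₁, hU₁, hmin₁⟩ := Finset.exists_min_image 𝓡 (fun U => (R U).card) h0
  by_cases hall : ∀ U ∈ 𝓡, R U₁ ⊆ R U
  · obtain ⟨t, ht⟩ := hne U₁ hU₁
    exact ⟨U₁, hU₁, U₁, hU₁, t, ht, t, ht, fun U hU => Or.inl (hall U hU ht)⟩
  simp only [not_forall] at hall
  obtain ⟨U₀, hU₀, hU₀'⟩ := hall
  set 𝓡' := 𝓡.filter fun U => ¬ R U₁ ⊆ R U
  have h0' : 𝓡'.Nonempty := ⟨U₀, Finset.mem_filter.2 ⟨hU₀, hU₀'⟩⟩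
  obtain ⟨U₂, hU₂', hmin₂⟩ := Finset.exists_min_image 𝓡' (fun U => (R U₁ ∪ R U).card) h0'
  obtain ⟨hU₂, hn₁₂⟩ := Finset.mem_filter.1 hU₂'
  obtain ⟨p, hp₁, hp₂⟩ := Finset.not_subset.1 hn₁₂
  have hn₂₁ : ¬ R U₂ ⊆ R U₁ := by
    intro hsub
    have hcard : (R U₁).card ≤ (R U₂).card := hmin₁ U₂ hU₂
    exact hn₁₂ (Finset.eq_of_subset_of_card_le hsub hcard).symm.subset
  obtain ⟨q, hq₂, hq₁⟩ := Finset.not_subset.1 hn₂₁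
  refine ⟨U₁, hU₁, U₂, hU₂, p, hp₁, q, hq₂, fun U₃ hU₃ => ?_⟩
  by_contra hU₃
  rw [not_or] at hU₃
  obtain ⟨hp₃, hq₃⟩ := hU₃
  have hsub : R U₃ ⊆ R U₁ ∪ R U₂ := by
    intro r hr
    by_contra hr'
    rw [Finset.mem_union, not_or] at hr'
    exact h3 U₁ hU₁ U₂ hU₂ U₃ hU₃ p hp₁ q hq₂ r hr hp₂ hp₃ hq₁ hq₃ hr'.1 hr'.2
  have hU₃' : U₃ ∈ 𝓡' := Finset.mem_filter.2 ⟨hU₃, fun h => hp₃ (h hp₁)⟩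
  have hle : (R U₁ ∪ R U₂).card ≤ (R U₁ ∪ R U₃).card := hmin₂ U₃ hU₃'
  have hss : R U₁ ∪ R U₃ ⊂ R U₁ ∪ R U₂ := by
    refine Finset.ssubset_iff_subset_ne.2 ⟨Finset.union_subset Finset.subset_union_left
      (hsub.trans le_rfl), fun heq => ?_⟩
    have : q ∈ R U₁ ∪ R U₃ := by rw [heq]; exact Finset.mem_union_right _ hq₂
    rcases Finset.mem_union.1 this with h | h
    · exact hq₁ h
    · exact hq₃ h
  exact absurd (Finset.card_lt_card hss) (not_lt.2 hle)

end Corner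

end Summit.CriticalPhenomena.PercolationContinuityZ3.Theorems
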